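import Summits.NavierStokesRegularity.FunctionalMining.NoGo.SpiralJetNegativeMoment
import Summits.NavierStokesRegularity.FunctionalMining.MiddleEigenvalueMomentDoorLow
import Summits.NavierStokesRegularity.FunctionalMining.RateBudgets
import HarnessLib

/-!
# K1-Q2 below `q = 2`, part 2: the row `E.q=3/2|T_C|C3b` and the classification for every real `q > 1`

Search for candidate a priori estimates; no regularity claim. NS FUNCTIONAL MINING — NO-GO BRANCH
(cell `pub-nsfunc`, prove seat gen 14). **THEOREM (kernel): for EVERY real `q` with `1 < q < 2` and
EVERY `C`, `MiddleEigenvalueMomentRateBound q C` is FALSE on `T³`** (`not_middleEigenvalueMomentRateBound_of_lt_two`);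
in particular the K0 row `E.q=3/2|T_C|C3b` (`dZ_{3/2}/dt ≤ C‖λ₂⁺(S)‖_∞ Z_{3/2}`; verdict of record
DEAD ∀C, no-go Sieve K Theorem 2) is refuted in the kernel for every `C`
(`middleEigenvalueMomentRate_three_halves_killAll`). With the gen-13 kill-all for `q > 2`
(`middleEigenvalueMomentRate_killAll_rpow`) and Betchov–Miller at `q = 2`: **for every real `q > 1`,
`(∃ C, MiddleEigenvalueMomentRateBound q C) ↔ q = 2`** (`exists_middleEigenvalueMomentRateBound_iff_of_one_lt`).

Witness: the NEGATED spiral jet `−sfld`. Negating a field keeps `|ω|²` and flips `σ` (cubic in `∇v`)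
and the strain; `det(−S) = −det S = 0` and `tr(−S) = 0`, so `λ₂(−S) = 0 ≤ 0` everywhere
(`MiddleEigen.middle_eq_zero_of_det_eq_zero`), while `∫(|ω|²)^rσ(−sfld) = −∫(|ω|²)^rσ(sfld) > 0` for
`r = q/2 − 1 ∈ [−1/2, 0)` by part 1 (`integral_moment_neg`). The door is the `q > 1` backward door
`middleEigenvalueMomentRateFailsReal_of_nonpos_middle_of_one_lt` (`MiddleEigenvalueMomentDoorLow`: exact
Euler derivative of `Z_q` through the vector `C¹` weight `W ↦ ‖W‖^q`). Static facts about one explicit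
field refuting a family of candidate a priori inequalities; nothing about Navier–Stokes regularity is
asserted.
-/

noncomputable section

open MeasureTheory Set Function Filter Topology Metric
open scoped ContDiff Real

namespace Summit.NavierStokesRegularity.FunctionalMining

namespace SpiralJet

open Literature.Analysis.FunctionSpaces Literature.Analysis.FunctionSpaces.Torus
  Literature.Analysis.FluidPDE KillAll VorticityL4

/-! ## 1. Negating a field: `|ω|²` even, `σ` odd, strain odd -/

section Neg

variable {d : Type*} [Fintype d] [DecidableEq d]

/-- `∂ᵢ(−v) = −∂ᵢv`. [folklore] -/
theorem partialDeriv_neg_field (v : UnitAddTorus d → EuclideanSpace ℝ d) (i : d) (x : UnitAddTorus d) :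
    Torus.partialDeriv i (-v) x = -Torus.partialDeriv i v x :=
  Torus.partialDeriv_neg i v x

/-- `Wᵢⱼ(−v) = −Wᵢⱼ(v)`. [folklore] -/
theorem vorticityTensor_neg (v : UnitAddTorus d → EuclideanSpace ℝ d) (i j : d) (x : UnitAddTorus d) :
    torusVorticityTensor (-v) i j x = -torusVorticityTensor v i j x := by
  simp only [torusVorticityTensor, partialDeriv_neg_field, PiLp.neg_apply]
  ring

/-- `|ω(−v)|² = |ω(v)|²`. [folklore] -/
theorem vorticitySqAt_neg (v : UnitAddTorus d → EuclideanSpace ℝ d) (x : UnitAddTorus d) :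
    torusVorticitySqAt (-v) x = torusVorticitySqAt v x := by
  simp only [torusVorticitySqAt, partialDeriv_neg_field, PiLp.neg_apply]
  congr 1
  exact Finset.sum_congr rfl fun i _ => Finset.sum_congr rfl fun j _ => by ring

/-- `σ(−v) = −σ(v)` (the stretching density is cubic in `∇v`). [folklore] -/
theorem stretchingDensity_neg (v : UnitAddTorus d → EuclideanSpace ℝ d) (x : UnitAddTorus d) :
    torusStretchingDensity (-v) x = -torusStretchingDensity v x := by
  simp only [torusStretchingDensity, vorticityTensor_neg, partialDeriv_neg_field, PiLp.neg_apply,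
    neg_mul, mul_neg, neg_neg, Finset.sum_neg_distrib]

end Neg

/-- **`λ₂(S(−sfld)) = 0` everywhere**: the strain of the negated witness is `−S`, still symmetric,
trace free and singular. [ours] -/
theorem middle_nonpos_neg_sfld : ∀ x : UnitAddTorus (Fin 3), ∀ hx : (Matrix.of fun i j =>
    (Torus.partialDeriv j (-sfld) x i + Torus.partialDeriv i (-sfld) x j) / 2).IsHermitian,
    hx.eigenvalues₀ (Fin.cast (Fintype.card_fin 3).symm 1) ≤ 0 := by
  intro x hx
  have hM : (Matrix.of fun i j =>
      (Torus.partialDeriv j (-sfld) x i + Torus.partialDeriv i (-sfld) x j) / 2) = -strain x := by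
    ext i j
    simp only [strain, Matrix.of_apply, Matrix.neg_apply, partialDeriv_neg_field, PiLp.neg_apply]
    ring
  have hsym : (Matrix.of fun i j =>
      (Torus.partialDeriv j (-sfld) x i + Torus.partialDeriv i (-sfld) x j) / 2).IsSymm := by
    rw [hM]; exact (strain_isSymm x).neg
  have htr : (Matrix.of fun i j =>
      (Torus.partialDeriv j (-sfld) x i + Torus.partialDeriv i (-sfld) x j) / 2).trace = 0 := by
    rw [hM, Matrix.trace_neg, strain_trace, neg_zero]
  have hdet : (Matrix.of fun i j =>
      (Torus.partialDeriv j (-sfld) x i + Torus.partialDeriv i (-sfld) x j) / 2).det = 0 := by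
    rw [hM, Matrix.det_neg, strain_det, mul_zero]
  exact (MiddleEigen.middle_eq_zero_of_det_eq_zero (Fintype.card_fin 3) _ hsym htr hdet).le

/-- **The weighted stretching moment of the NEGATED spiral jet is positive for `r ∈ [−1/2, 0)`:**
`∫_{T³} (|ω|²)^r σ(−sfld) = −∫_{T³} (|ω|²)^r σ(sfld) > 0`. [ours] -/
theorem integral_moment_neg_sfld_pos {r : ℝ} (hr1 : -1 / 2 ≤ r) (hr : r < 0) :
    0 < ∫ ξ : UnitAddTorus (Fin 3),
      torusVorticitySqAt (-sfld) ξ ^ r * torusStretchingDensity (-sfld) ξ := by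
  have h := integral_moment_neg hr1 hr
  simp only [vorticitySqAt_neg, stretchingDensity_neg, mul_neg, integral_neg]
  linarith

/-! ## 2. Through the `q > 1` door -/

/-- **KILL-ALL BELOW `q = 2` (K1-Q2), kernel form.** For every real `q` with `1 < q < 2` and every
`C`, the middle-eigenvalue moment rate law `dZ_q/dt ≤ C‖λ₂⁺(S)‖_∞ Z_q`
(`MiddleEigenvalueMomentRateBound q C`) fails on `T³`: the negated spiral jet has `λ₂(S) ≡ 0` and
`q∫(|ω|²)^{q/2−1}σ > 0`, contradicting the static consequence of the law (door
`middleEigenvalueMomentRateFailsReal_of_nonpos_middle_of_one_lt`). Search for candidate a priori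
estimates; no regularity claim. [ours] -/
theorem not_middleEigenvalueMomentRateBound_of_lt_two {q : ℝ} (hq1 : 1 < q) (hq2 : q < 2) (C : ℝ) :
    ¬ MiddleEigenvalueMomentRateBound (d := Fin 3) q C := by
  have hr1 : -1 / 2 ≤ q / 2 - 1 := by linarith
  have hr : q / 2 - 1 < 0 := by linarith
  have hpos : 0 < q * ∫ ξ : UnitAddTorus (Fin 3),
      torusVorticitySqAt (-sfld) ξ ^ (q / 2 - 1) * torusStretchingDensity (-sfld) ξ :=
    mul_pos (by linarith) (integral_moment_neg_sfld_pos hr1 hr)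
  exact middleEigenvalueMomentRateFailsReal_of_nonpos_middle_of_one_lt hq1 (Fintype.card_fin 3)
    isSmooth_sfld.neg (isDivFree_neg isDivFree_sfld) middle_nonpos_neg_sfld hpos C

/-- K0 row **`E.q=3/2|T_C|C3b`** (`dZ_{3/2}/dt ≤ C‖λ₂⁺‖_∞Z_{3/2}`): FALSE for every `C` (kernel). Search for
candidate a priori estimates; no regularity claim. [ours] -/
theorem middleEigenvalueMomentRate_three_halves_killAll :
    ∀ C : ℝ, ¬ MiddleEigenvalueMomentRateBound (d := Fin 3) (3 / 2) C :=
  not_middleEigenvalueMomentRateBound_of_lt_two (by norm_num) (by norm_num)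

/-- **ALL-`q` KILL-ALL, every real `q > 1`, `q ≠ 2`:** `MiddleEigenvalueMomentRateBound q C` fails for
every `C` (below `2`: this file; above `2`: `middleEigenvalueMomentRate_killAll_rpow`). Search for
candidate a priori estimates; no regularity claim. [ours] -/
theorem middleEigenvalueMomentRate_killAll_real {q : ℝ} (hq : 1 < q) (hq2 : q ≠ 2) (C : ℝ) :
    ¬ MiddleEigenvalueMomentRateBound (d := Fin 3) q C := by
  rcases lt_or_gt_of_ne hq2 with h | h
  · exact not_middleEigenvalueMomentRateBound_of_lt_two hq h C
  · exact not_middleEigenvalueMomentRateBound_rpow h C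

/-- **The K1-Q2 family `{dZ_q/dt ≤ C‖λ₂⁺(S)‖_∞Z_q : q > 1}` has EXACTLY ONE true member, `q = 2`
(kernel):** for every real `q > 1`, some constant works iff `q = 2` (Betchov–Miller `C = 2`, tree
`middleEigenvalueMomentRateBound_two`). Extends the gen-13 classification (`q ≥ 2`,
`exists_middleEigenvalueMomentRateBound_iff`) below `q = 2`. Search for candidate a priori estimates;
no regularity claim. [ours] -/
theorem exists_middleEigenvalueMomentRateBound_iff_of_one_lt {q : ℝ} (hq : 1 < q) :
    (∃ C : ℝ, MiddleEigenvalueMomentRateBound (d := Fin 3) q C) ↔ q = 2 := by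
  refine ⟨fun ⟨C, hC⟩ => ?_, fun h => ⟨2, by rw [h]; exact middleEigenvalueMomentRateBound_two⟩⟩
  by_contra hne
  exact middleEigenvalueMomentRate_killAll_real hq hne C hC

/-! ## 3. The static node classified too (appended, gen 14) -/

/-- **The STATIC middle-eigenvalue inequality is false for every real `q > 1`, `q ≠ 2`, and every `C`**
(`MiddleEigenvalueStretchingStaticReal q C`: `q∫(|ω|²)^{q/2−1}σ ≤ CΛZ_q` for all smooth divergence-free
fields with `λ₂ ≤ Λ`): directly from the witnesses at `Λ = 0` — the negated spiral jet below `q = 2`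
(`integral_moment_neg_sfld_pos`), the spiral jet above (`integral_moment_pos`); no door needed. Search
for candidate a priori estimates; no regularity claim. [ours] -/
theorem not_middleEigenvalueStretchingStaticReal_real {q : ℝ} (hq : 1 < q) (hq2 : q ≠ 2) (C : ℝ) :
    ¬ MiddleEigenvalueStretchingStaticReal (d := Fin 3) q C := by
  intro h
  rcases lt_or_gt_of_ne hq2 with h2 | h2
  · have hst := h (Fintype.card_fin 3) (-sfld) isSmooth_sfld.neg (isDivFree_neg isDivFree_sfld) 0 le_rfl
      middle_nonpos_neg_sfld
    have hpos : 0 < q * ∫ ξ : UnitAddTorus (Fin 3),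
        torusVorticitySqAt (-sfld) ξ ^ (q / 2 - 1) * torusStretchingDensity (-sfld) ξ :=
      mul_pos (by linarith) (integral_moment_neg_sfld_pos (by linarith) (by linarith))
    have : C * 0 * torusVorticityMoment q (-sfld) = 0 := by ring
    linarith
  · have hst := h (Fintype.card_fin 3) sfld isSmooth_sfld isDivFree_sfld 0 le_rfl middle_nonpos_sfld
    have hpos : 0 < q * ∫ ξ : UnitAddTorus (Fin 3),
        torusVorticitySqAt sfld ξ ^ (q / 2 - 1) * torusStretchingDensity sfld ξ :=
      mul_pos (by linarith) (integral_moment_pos (by linarith))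
    have : C * 0 * torusVorticityMoment q sfld = 0 := by ring
    linarith

/-- **The static node classified (kernel): for every real `q > 1`,
`(∃ C, MiddleEigenvalueStretchingStaticReal q C) ↔ q = 2`** (Betchov–Miller `C = 2` at `q = 2`,
`middleEigenvalueStretchingStaticReal_two`). Search for candidate a priori estimates; no regularity claim.
[ours] -/
theorem exists_middleEigenvalueStretchingStaticReal_iff_of_one_lt {q : ℝ} (hq : 1 < q) :
    (∃ C : ℝ, MiddleEigenvalueStretchingStaticReal (d := Fin 3) q C) ↔ q = 2 := by
  refine ⟨fun ⟨C, hC⟩ => ?_, fun h => ⟨2, by rw [h]; exact middleEigenvalueStretchingStaticReal_two⟩⟩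
  by_contra hne
  exact not_middleEigenvalueStretchingStaticReal_real hq hne C hC

end SpiralJet

end Summit.NavierStokesRegularity.FunctionalMining

end
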